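import Mathlib.Analysis.Normed.Operator.Basic
import Mathlib.Analysis.Normed.Module.FiniteDimension
import Mathlib.Analysis.Normed.Module.RCLike.Real
import Mathlib.Topology.Algebra.Module.FiniteDimension
import Mathlib.Topology.Algebra.MvPolynomial
import Mathlib.Topology.MetricSpace.ProperSpace
import Mathlib.Topology.Order.Compact
import Literature.Dynamics.SwitchedSystems.JointSpectralRadius
import HarnessLib

/-!
# Path-complete graph Lyapunov functions bound the joint spectral radius (AJPR Theorem 2.4)

Topic `Literature/Dynamics/SwitchedSystems` (definition item `defn-IsPathCompleteLyapunov`, part (2)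
"the basic soundness fact wanted as a theorem").  Builds on `PathCompleteLyapunov.lean` (the
certificates) and `JointSpectralRadius.lean` (`ρ`).

**Theorem 2.4 of Ahmadi–Jungers–Parrilo–Roozbehani** [AhmadiEtAl2014]: let `G` be a path-complete
graph and `{V_i}` one function per node, positive (definite), continuous and homogeneous, forming a
graph Lyapunov function for the scaled family `𝒜_γ = {γ A_1, …, γ A_m}`; then `ρ(𝒜) ≤ 1/γ`.
In the conventions of `PathCompleteLyapunov.lean` (explicit multiplicative factor `c` on the
edges, node functions positively homogeneous of degree `d ≥ 1`) the statement reads: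
`IsPathCompleteLyapunov G A univ c V` ⟹ `ρ(A) ≤ c^{1/d}` (`jointSpectralRadius_le_of_isPathCompleteLyapunov`),
and in RATE form (`c = γ^d`): `ρ(A) ≤ γ` (`jointSpectralRadius_le_of_isPathCompleteLyapunov_rate`).
The proof is AJPR's (p. 7 of the arXiv version): compactness of the unit sphere gives
`α ‖x‖^d ≤ V_i(x) ≤ β ‖x‖^d` uniformly over the finitely many nodes (`exists_norm_pow_sandwich`);
along the path labelled by a word `w` of length `k` the chain of edge inequalities gives
`V_j(A_w x) ≤ c^k V_i(x)` (`IsGraphLyapunovFunction.apply_wordAct_le`, in `PathCompleteLyapunov.lean`);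
hence `‖A_w‖ ≤ (β/α)^{1/d} (c^{1/d})^k`, and the `k`-th root kills the constant
(`jointSpectralRadius_le_of_norm_prodWord_le`, in `JointSpectralRadius.lean`).

Hypotheses, compared with the source: AJPR ask `V_i(λ x) = λ^d V_i(x)` for all real `λ`; only
`λ > 0` is used (positive homogeneity), which is what we assume — so norms (`d = 1`) and polytopic
functions are covered literally.  "Positive" means positive definite (`V_i(x) > 0` for `x ≠ 0`),
as in AJPR's proof ("by positivity … `0 < α_i`").  The state space is any finite-dimensional real
normed space `E` and the letters act by continuous linear maps `A b : E →L[ℝ] E`; `ρ` is taken in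
the operator-norm ring `E →L[ℝ] E` (any other submultiplicative norm gives the same `ρ`,
`jointSpectralRadius_map_eq`).  Matrix families enter through `Matrix.toLin'`
(`jointSpectralRadius_le_of_isPathCompleteLyapunov_matrix`).

Corollary: **Parrilo–Jadbabaie's Theorem 2.2** [ParriloJadbabaie2008] — an SOS Lyapunov
certificate of degree `2d` and rate `γ ≥ 0` (`IsSosLyapunovCertificate`, the programme
`ρ_{SOS,2d}`) certifies `ρ(𝒜) ≤ γ` (`IsSosLyapunovCertificate.jointSpectralRadius_le`).
-/

open Filter Topology Set
open scoped ENNReal NNReal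

namespace Literature.Dynamics.SwitchedSystems

section Sandwich

variable {E : Type*} [NormedAddCommGroup E] [NormedSpace ℝ E]

/-- A positively homogeneous function of degree `d ≥ 1` vanishes at the origin. [folklore] -/
theorem apply_zero_of_homogeneous {V : E → ℝ} {d : ℕ} (hd : 1 ≤ d)
    (hhom : ∀ (t : ℝ) (x : E), 0 < t → V (t • x) = t ^ d * V x) : V 0 = 0 := by
  have h := hhom 2 0 two_pos
  rw [smul_zero] at h
  have h2 : (2 : ℝ) ^ d ≠ 1 := by
    apply ne_of_gt
    exact one_lt_pow₀ (by norm_num) (by omega)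
  have : ((2 : ℝ) ^ d - 1) * V 0 = 0 := by linarith
  rcases mul_eq_zero.1 this with h' | h'
  · exact absurd (sub_eq_zero.1 h') h2
  · exact h'

variable [FiniteDimensional ℝ E]

/-- **The norm sandwich** (first step of the proof of [AhmadiEtAl2014, Thm. 2.4]): a continuous,
positive definite, positively homogeneous function of degree `d ≥ 1` on a finite-dimensional real
normed space satisfies `α ‖x‖^d ≤ V x ≤ β ‖x‖^d` for some constants `0 < α ≤ β` (compactness of
the unit sphere). [cite: AhmadiEtAl2014, §2, proof of Thm. 2.4 (the constants α_i, β_i)] -/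
theorem exists_norm_pow_sandwich {V : E → ℝ} {d : ℕ} (hd : 1 ≤ d) (hcont : Continuous V)
    (hpos : ∀ x, x ≠ 0 → 0 < V x) (hhom : ∀ (t : ℝ) (x : E), 0 < t → V (t • x) = t ^ d * V x) :
    ∃ α β : ℝ, 0 < α ∧ α ≤ β ∧ ∀ x, α * ‖x‖ ^ d ≤ V x ∧ V x ≤ β * ‖x‖ ^ d := by
  have hV0 : V 0 = 0 := apply_zero_of_homogeneous hd hhom
  rcases subsingleton_or_nontrivial E with hE | hE
  · refine ⟨1, 1, one_pos, le_rfl, fun x => ?_⟩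
    rw [Subsingleton.elim x 0, hV0, norm_zero, zero_pow (by omega), mul_zero]
    exact ⟨le_rfl, le_rfl⟩
  · have hS : IsCompact (Metric.sphere (0 : E) 1) := isCompact_sphere 0 1
    have hSne : (Metric.sphere (0 : E) 1).Nonempty := NormedSpace.sphere_nonempty.2 zero_le_one
    obtain ⟨u, huS, hu⟩ := hS.exists_isMinOn hSne hcont.continuousOn
    obtain ⟨v, hvS, hv⟩ := hS.exists_isMaxOn hSne hcont.continuousOn
    have hu0 : u ≠ 0 := by
      rintro rfl
      simp at huS
    have hαβ : V u ≤ V v := hu hvS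
    refine ⟨V u, V v, hpos u hu0, hαβ, fun x => ?_⟩
    rcases eq_or_ne x 0 with rfl | hx
    · rw [hV0, norm_zero, zero_pow (by omega), mul_zero, mul_zero]
      exact ⟨le_rfl, le_rfl⟩
    · have hnx : 0 < ‖x‖ := norm_pos_iff.2 hx
      set y : E := ‖x‖⁻¹ • x with hy
      have hyS : y ∈ Metric.sphere (0 : E) 1 := by
        rw [mem_sphere_zero_iff_norm, hy, norm_smul, norm_inv, norm_norm,
          inv_mul_cancel₀ hnx.ne']
      have hxy : x = ‖x‖ • y := by
        rw [hy, smul_smul, mul_inv_cancel₀ hnx.ne', one_smul]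
      have hVx : V x = ‖x‖ ^ d * V y := by
        conv_lhs => rw [hxy]
        exact hhom _ _ hnx
      rw [hVx, mul_comm (V u), mul_comm (V v)]
      exact ⟨mul_le_mul_of_nonneg_left (hu hyS) (by positivity),
        mul_le_mul_of_nonneg_left (hv hyS) (by positivity)⟩

end Sandwich

section Main

variable {σ N : Type*} {E : Type*} [NormedAddCommGroup E] [NormedSpace ℝ E]
  [FiniteDimensional ℝ E]

omit [FiniteDimensional ℝ E] in
/-- Products of words act as the word (operator version). [folklore] -/
theorem prodWord_apply (A : σ → E →L[ℝ] E) (w : List σ) (x : E) :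
    prodWord A w x = wordAct (fun b y => A b y) w x := by
  induction w generalizing x with
  | nil => simp
  | cons b w ih => simp [ih]

/-- **Ahmadi–Jungers–Parrilo–Roozbehani, Theorem 2.4** (path-complete graph Lyapunov functions
bound the joint spectral radius).  Let `A b : E →L[ℝ] E` (`b : σ`) act on a finite-dimensional real
normed space, let `G` be a path-complete labelled digraph on finitely many nodes, and let
`V i : E → ℝ` be continuous, positive definite and positively homogeneous of degree `d ≥ 1`, with
`V j (A b x) ≤ c * V i x` along every edge `i —b→ j` (`c ≥ 0`).  Then `ρ(A) ≤ c^{1/d}`.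
(AJPR's formulation: the GLF inequalities for the scaled family `γ A` give `ρ(A) ≤ 1/γ`; with
degree-`d` homogeneity that is `c = γ^{-d}`.) [cite: AhmadiEtAl2014, §2, Thm. 2.4] -/
theorem jointSpectralRadius_le_of_isPathCompleteLyapunov [Finite N] {G : LabeledDigraph σ N}
    {A : σ → E →L[ℝ] E} {c : ℝ} {V : N → E → ℝ} {d : ℕ}
    (h : IsPathCompleteLyapunov G (fun b x => A b x) Set.univ c V) (hc : 0 ≤ c) (hd : 1 ≤ d)
    (hcont : ∀ i, Continuous (V i)) (hpos : ∀ i x, x ≠ 0 → 0 < V i x)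
    (hhom : ∀ i (t : ℝ) (x : E), 0 < t → V i (t • x) = t ^ d * V i x) :
    jointSpectralRadius A ≤ ENNReal.ofReal (c ^ (1 / (d : ℝ))) := by
  classical
  haveI := Fintype.ofFinite N
  have hne : Nonempty N := h.isPathComplete.nonempty
  -- uniform sandwich constants over the finitely many nodes
  choose α β hα hαβ hsand using fun i =>
    exists_norm_pow_sandwich hd (hcont i) (hpos i) (hhom i)
  set α₀ : ℝ := Finset.univ.inf' Finset.univ_nonempty α with hα₀
  set β₀ : ℝ := Finset.univ.sup' Finset.univ_nonempty β with hβ₀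
  have hα₀pos : 0 < α₀ := (Finset.lt_inf'_iff _).2 fun i _ => hα i
  have hα₀le : ∀ i, α₀ ≤ α i := fun i => Finset.inf'_le _ (Finset.mem_univ i)
  have hleβ₀ : ∀ i, β i ≤ β₀ := fun i => Finset.le_sup' _ (Finset.mem_univ i)
  have hβ₀pos : 0 < β₀ := by
    obtain ⟨i⟩ := hne
    exact hα₀pos.trans_le ((hα₀le i).trans ((hαβ i).trans (hleβ₀ i)))
  have hd0 : d ≠ 0 := by omega
  -- the constants of the exponential bound `‖A_w‖ ≤ D * L ^ |w|`
  set D : ℝ := (β₀ / α₀) ^ ((d : ℝ)⁻¹) with hD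
  set L : ℝ := c ^ ((d : ℝ)⁻¹) with hL
  have hDnn : 0 ≤ D := Real.rpow_nonneg (by positivity) _
  have hLnn : 0 ≤ L := Real.rpow_nonneg hc _
  have hbound : ∀ w : List σ, ‖prodWord A w‖ ≤ D * L ^ w.length := by
    intro w
    obtain ⟨i, j, hp, hV⟩ := h.exists_apply_wordAct_le (fun b => Set.mapsTo_univ _ _) hc w
    -- `K ^ d = c^k β₀ / α₀` and `‖A_w x‖ ≤ K ‖x‖`
    set K : ℝ := (c ^ w.length * (β₀ / α₀)) ^ ((d : ℝ)⁻¹) with hK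
    have hKnn : 0 ≤ K := Real.rpow_nonneg (by positivity) _
    have hKd : K ^ d = c ^ w.length * (β₀ / α₀) := Real.rpow_inv_natCast_pow (by positivity) hd0
    have hKx : ∀ x : E, ‖prodWord A w x‖ ≤ K * ‖x‖ := by
      intro x
      have h1 : α₀ * ‖prodWord A w x‖ ^ d ≤ c ^ w.length * (β₀ * ‖x‖ ^ d) := by
        calc α₀ * ‖prodWord A w x‖ ^ d ≤ α j * ‖prodWord A w x‖ ^ d :=
              mul_le_mul_of_nonneg_right (hα₀le j) (by positivity)
          _ ≤ V j (prodWord A w x) := (hsand j _).1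
          _ = V j (wordAct (fun b y => A b y) w x) := by rw [prodWord_apply]
          _ ≤ c ^ w.length * V i x := hV (Set.mem_univ x)
          _ ≤ c ^ w.length * (β i * ‖x‖ ^ d) :=
              mul_le_mul_of_nonneg_left (hsand i x).2 (by positivity)
          _ ≤ c ^ w.length * (β₀ * ‖x‖ ^ d) := by gcongr; exact hleβ₀ i
      have h2 : ‖prodWord A w x‖ ^ d ≤ (K * ‖x‖) ^ d := by
        rw [mul_pow, hKd]
        calc ‖prodWord A w x‖ ^ d ≤ c ^ w.length * (β₀ * ‖x‖ ^ d) / α₀ :=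
              (le_div_iff₀' hα₀pos).2 h1
          _ = c ^ w.length * (β₀ / α₀) * ‖x‖ ^ d := by ring
      exact (pow_le_pow_iff_left₀ (norm_nonneg _) (by positivity) hd0).1 h2
    have hKeq : K = D * L ^ w.length := by
      rw [hK, Real.mul_rpow (by positivity) (by positivity), hD, hL, mul_comm,
        Real.rpow_pow_comm hc]
    rw [← hKeq]
    exact ContinuousLinearMap.opNorm_le_bound _ hKnn hKx
  have := jointSpectralRadius_le_of_norm_prodWord_le A hDnn hLnn hbound
  simpa only [hL, one_div] using this

/-- **Theorem 2.4 in rate form**: edge inequalities `V j (A b x) ≤ γ^d · V i x` (`γ ≥ 0`) with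
degree-`d` node functions certify `ρ(A) ≤ γ` — for `d = 1` (norms, polytopic functions) the
factor is the rate itself, for quadratic nodes it is `γ²`, for SOS nodes of degree `2d` it is
`γ^{2d}`. [cite: AhmadiEtAl2014, §2, Thm. 2.4] -/
theorem jointSpectralRadius_le_of_isPathCompleteLyapunov_rate [Finite N] {G : LabeledDigraph σ N}
    {A : σ → E →L[ℝ] E} {γ : ℝ} {V : N → E → ℝ} {d : ℕ}
    (h : IsPathCompleteLyapunov G (fun b x => A b x) Set.univ (γ ^ d) V) (hγ : 0 ≤ γ) (hd : 1 ≤ d)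
    (hcont : ∀ i, Continuous (V i)) (hpos : ∀ i x, x ≠ 0 → 0 < V i x)
    (hhom : ∀ i (t : ℝ) (x : E), 0 < t → V i (t • x) = t ^ d * V i x) :
    jointSpectralRadius A ≤ ENNReal.ofReal γ := by
  have := jointSpectralRadius_le_of_isPathCompleteLyapunov h (by positivity) hd hcont hpos hhom
  rwa [one_div, Real.pow_rpow_inv_natCast hγ (by omega)] at this

end Main

/-! ### Independence of the norm in finite dimension -/

section NormIndependence

variable {σ R S : Type*} [NormedRing R] [NormedAlgebra ℝ R] [FiniteDimensional ℝ R]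
  [NormedRing S] [NormedAlgebra ℝ S]

/-- **Independence of the norm, finite-dimensional algebras**: an algebra isomorphism between
real normed algebras, the source finite-dimensional (e.g. the identity of the matrix algebra between two
submultiplicative matrix norms, or `Matrix.toLinAlgEquiv'` to the operators on a normed `ℝⁿ`)
preserves the joint spectral radius of every finite family — both directions are automatically
bounded linear maps.  "The quantity `ρ(A)` is independent of the norm used in (1.1)."
[cite: AhmadiEtAl2014, §1, after (1.1) (independence of the norm)] -/
theorem jointSpectralRadius_algEquiv [Finite σ] (e : R ≃ₐ[ℝ] S) (A : σ → R) :
    jointSpectralRadius (fun b => e (A b)) = jointSpectralRadius A := by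
  set L : R ≃L[ℝ] S := e.toLinearEquiv.toContinuousLinearEquiv with hL
  have he : ∀ x, ‖e x‖₊ ≤ ‖(L : R →L[ℝ] S)‖₊ * ‖x‖₊ := fun x =>
    (L : R →L[ℝ] S).le_opNNNorm x
  have he' : ∀ y, ‖e.symm y‖₊ ≤ ‖(L.symm : S →L[ℝ] R)‖₊ * ‖y‖₊ := fun y =>
    (L.symm : S →L[ℝ] R).le_opNNNorm y
  exact jointSpectralRadius_map_eq e.toMulEquiv he he' A

end NormIndependence

/-! ### Matrix families and the Parrilo–Jadbabaie SOS bound -/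

section Matrices

variable {σ N ι : Type*} [Fintype ι] [DecidableEq ι]

/-- The operator on `ι → ℝ` (sup norm) of a real square matrix, as a continuous linear map; the
joint spectral radius of a matrix family is taken through this map (operator norm for `‖·‖_∞`,
i.e. the max-row-sum norm; any other norm gives the same value, `jointSpectralRadius_map_eq`).
[folklore] -/
noncomputable def matrixToCLM (M : Matrix ι ι ℝ) : (ι → ℝ) →L[ℝ] (ι → ℝ) :=
  LinearMap.toContinuousLinearMap (Matrix.toLin' M)

/-- `matrixToCLM M x = M x`. [folklore] -/
@[simp] theorem matrixToCLM_apply (M : Matrix ι ι ℝ) (x : ι → ℝ) :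
    matrixToCLM M x = M.mulVec x := by
  simp [matrixToCLM]

/-- `matrixToCLM` is multiplicative. [folklore] -/
theorem matrixToCLM_mul (M M' : Matrix ι ι ℝ) :
    matrixToCLM (M * M') = matrixToCLM M * matrixToCLM M' := by
  ext x : 1
  simp [Matrix.mulVec_mulVec]

/-- `matrixToCLM 1 = 1`. [folklore] -/
@[simp] theorem matrixToCLM_one : matrixToCLM (1 : Matrix ι ι ℝ) = 1 := by
  ext x : 1
  simp

/-- `matrixToCLM` as a monoid homomorphism (so that `map_prodWord` applies). [folklore] -/
noncomputable def matrixToCLMHom : Matrix ι ι ℝ →* ((ι → ℝ) →L[ℝ] (ι → ℝ)) where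
  toFun := matrixToCLM
  map_one' := matrixToCLM_one
  map_mul' := matrixToCLM_mul

/-- [folklore] -/
@[simp] theorem matrixToCLMHom_apply (M : Matrix ι ι ℝ) : matrixToCLMHom M = matrixToCLM M := rfl

/-- **Max-row-sum bound ⟹ operator-norm bound** on `(ι → ℝ, ‖·‖_∞)`: if every absolute row
sum of `M` is `≤ C` then `‖matrixToCLM M‖ ≤ C` (the operator norm for the sup norm IS the
max-row-sum norm, cf. `Matrix.linfty_opNorm_def`; only this inequality is needed here).  This is
the norm used by Tsitsiklis–Blondel. [folklore] -/
theorem norm_matrixToCLM_le_of_rowSum_le (M : Matrix ι ι ℝ) {C : ℝ} (hC : 0 ≤ C)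
    (h : ∀ i, ∑ j, |M i j| ≤ C) : ‖matrixToCLM M‖ ≤ C := by
  refine ContinuousLinearMap.opNorm_le_bound _ hC fun x => ?_
  rw [pi_norm_le_iff_of_nonneg (by positivity)]
  intro i
  rw [matrixToCLM_apply, Real.norm_eq_abs]
  calc |M.mulVec x i| = |∑ j, M i j * x j| := rfl
    _ ≤ ∑ j, |M i j * x j| := Finset.abs_sum_le_sum_abs _ _
    _ = ∑ j, |M i j| * |x j| := by simp only [abs_mul]
    _ ≤ ∑ j, |M i j| * ‖x‖ := by
        refine Finset.sum_le_sum fun j _ => mul_le_mul_of_nonneg_left ?_ (abs_nonneg _)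
        simpa only [Real.norm_eq_abs] using norm_le_pi_norm x j
    _ = (∑ j, |M i j|) * ‖x‖ := (Finset.sum_mul _ _ _).symm
    _ ≤ C * ‖x‖ := mul_le_mul_of_nonneg_right (h i) (norm_nonneg _)

/-- **Row-sum bounds on all products of a fixed length bound `ρ`**: if every product
`A_w = A w[k-1] ⋯ A w[0]` of `k ≥ 1` matrices of the family has all absolute row sums `≤ C`, then
`ρ(A) ≤ C^{1/k}`.  With `k = n + 2`, `C = m - 1` this is the UNSAT half of the Tsitsiklis–Blondel
reduction ("every product of `n + 2` factors has max-row-sum norm `≤ m - 1`", [TsitsiklisBlondel1997,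
§2, p. 36]); the products are `prodWord A w` (= `wordProd A w` of `TsitsiklisBlondel.lean` for the
alphabet `Bool`, by `prodWord_eq_foldl`). [cite: AhmadiEtAl2014, §1, (1.1)] -/
theorem jointSpectralRadius_matrix_le_of_rowSum_prodWord_le (A : σ → Matrix ι ι ℝ) {k : ℕ}
    (hk : 1 ≤ k) {C : ℝ} (hC : 0 ≤ C)
    (h : ∀ w : List σ, w.length = k → ∀ i, ∑ j, |prodWord A w i j| ≤ C) :
    jointSpectralRadius (fun b => matrixToCLM (A b)) ≤ ENNReal.ofReal (C ^ (1 / (k : ℝ))) := by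
  refine jointSpectralRadius_le_of_forall_norm_prodWord_le _ hk hC fun w hw => ?_
  have hmap : prodWord (fun b => matrixToCLM (A b)) w = matrixToCLM (prodWord A w) := by
    simpa only [matrixToCLMHom_apply] using (map_prodWord matrixToCLMHom A w).symm
  rw [hmap]
  exact norm_matrixToCLM_le_of_rowSum_le _ hC (h w hw)

/-- **Theorem 2.4 for matrix families**: a path-complete graph Lyapunov function for the maps
`x ↦ A b x` (`A b : Matrix ι ι ℝ`) with factor `c ≥ 0` and continuous, positive definite,
degree-`d` positively homogeneous node functions gives `ρ(A) ≤ c^{1/d}`.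
[cite: AhmadiEtAl2014, §2, Thm. 2.4] -/
theorem jointSpectralRadius_le_of_isPathCompleteLyapunov_matrix [Finite N]
    {G : LabeledDigraph σ N} {A : σ → Matrix ι ι ℝ} {c : ℝ} {V : N → (ι → ℝ) → ℝ} {d : ℕ}
    (h : IsPathCompleteLyapunov G (fun b x => (A b).mulVec x) Set.univ c V) (hc : 0 ≤ c)
    (hd : 1 ≤ d) (hcont : ∀ i, Continuous (V i)) (hpos : ∀ i x, x ≠ 0 → 0 < V i x)
    (hhom : ∀ i (t : ℝ) (x : ι → ℝ), 0 < t → V i (t • x) = t ^ d * V i x) :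
    jointSpectralRadius (fun b => matrixToCLM (A b)) ≤ ENNReal.ofReal (c ^ (1 / (d : ℝ))) := by
  have h' : IsPathCompleteLyapunov G (fun b x => matrixToCLM (A b) x) Set.univ c V := by
    simpa only [matrixToCLM_apply] using h
  exact jointSpectralRadius_le_of_isPathCompleteLyapunov h' hc hd hcont hpos hhom

open MvPolynomial in
/-- **Parrilo–Jadbabaie, Theorem 2.2 (via the SOS programme `ρ_{SOS,2d}`)**: an SOS Lyapunov
certificate of degree `2d` and rate `γ ≥ 0` for the real matrix family `A` certifies
`ρ(A) ≤ γ`.  (`p` is continuous, positive definite by the `ε (∑ xᵢ²)ᵈ` normalisation, homogeneous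
of degree `2d`, and a common Lyapunov function with factor `γ^{2d}`: the one-node case of
Theorem 2.4.) [cite: ParriloJadbabaie2008, Thm. 2.2 and §2.1] -/
theorem IsSosLyapunovCertificate.jointSpectralRadius_le {A : σ → Matrix ι ι ℝ} {γ : ℝ} {d : ℕ}
    {p : MvPolynomial ι ℝ} (h : IsSosLyapunovCertificate A γ d p) (hγ : 0 ≤ γ) :
    jointSpectralRadius (fun b => matrixToCLM (A b)) ≤ ENNReal.ofReal γ := by
  have h' : IsPathCompleteLyapunov (LabeledDigraph.complete σ Unit)
      (fun b x => matrixToCLM (A b) x) Set.univ (γ ^ (2 * d)) (fun _ x => eval x p) := by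
    simpa only [matrixToCLM_apply] using h.isPathCompleteLyapunov
  have hd : 1 ≤ 2 * d := by have := h.one_le_deg; omega
  exact jointSpectralRadius_le_of_isPathCompleteLyapunov_rate h' hγ hd
    (fun _ => MvPolynomial.continuous_eval p) (fun _ x hx => h.eval_pos hx)
    (fun _ t x _ => h.eval_smul t x)

end Matrices

end Literature.Dynamics.SwitchedSystems
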